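import Summits.BirchSwinnertonDyer.BirchSwinnertonDyer.Theorems.ManinLocalTwoThreeTwoShiftTower
import Mathlib.Algebra.CharP.Two
import HarnessLib

/-!
# The 2-ADIC TWIN, IV: the ω-part — an `ε`-eigenfunction of the 2-shift with `ε ≠ 1` has NO obstruction at the two low depths
# (explicit pairs `χ₄ ∘ d`, `χ₈ ∘ d`; es's THEOREM-V trick at `p = 2`), hence the eigen tower `K^ε(2m) = 0 ⟹ K^ε(4m) = 0` for every `m`
# (route `ManinLocalTwoThree`, cell bsd-f2-manin; crux C2 `ManinOddAtFour` stmt-BirchSwinnertonDyer-22967; prover seat p3 gen 11)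

Over `𝔽₂` the 8-shift `σ³` splits as `x³ − 1 = (x − 1)(x² + x + 1)`: G₈ needs, besides G₂, the vanishing of the ω-PART — additive
`η : Γ₀(N) → K` (`K` of characteristic `2`) with `η(a, 2b; c, d) = ε·η(a, b; 2c, d)`, `ε³ = 1 ≠ ε` — the `p = 2` twin of the anti-invariant tower `K₃⁻ = 0`.
For such `η` on `Γ₀(4m)` the descent obstruction `η(P_{1/2})` of `TwoShift.descent` VANISHES at every depth (**`apply_Phalf_eq_zero_of_ne_one`**):
* `4 ∣ m`: for every `ε` (file III, `P_{1/2}` is the shift of a square);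
* `m` odd: es's two-functional trick (MEMO-es §37.13 (B), tree `…ThreeShiftAntiDescentThree.lean`) with the EXPLICIT non-gluable pair
  `(χ₄∘d|_A, χ₄∘d|_B)` (defect `χ₄(1+4m) − χ₄(1+2m) = 1`): if `η(P_{1/2}) ≠ 0` the corrected pair glues to an additive `W` on `Γ₀(2m)`, and
  evaluating `W` on `g P_{1/2} g⁻¹ = y` with the explicit `g = (1+6t, −3t; 6m², 4−3m²)` (`m² = 1 + 8t`, `g(1,2)ᵀ = (1,8)ᵀ`) and
  `y = (1−8m, m; −64m, 1+8m)` (`η(y) = 0`: `y` shifts to `u_{1/4}²`) forces `ε = 1`;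
* `m = 2k`, `k` odd: the same with `χ₈ ∘ d` (defect `χ₈(1+8k) − χ₈(1+4k) = 1`) and `P_{1/2} = x²`, `x = (1−2k, k; −4k, 1+2k) ∈ Γ₀(4k)`.
So **`eigen_step : ShiftEigenTrivialAt (2m) ε → ShiftEigenTrivialAt (4m) ε`** for every `m ≥ 1` and every `ε ≠ 0, 1` in a field `K ⊇ 𝔽₂`
— NO Heisenberg lift and NO freeness input at `p = 2` (at `p = 3` the `9 ∥ M` steps needed E-es-108).  The base `K^ε(N₀) = 0`, `N₀` odd, is
p2's `shiftCompatiblePair_eq` (any `K` with `2K = 0`); the index-3 step `N₀ → 2N₀` is the remaining node (file V).  Nothing about BSD,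
Manin's conjecture or C2 is asserted here.  Reference: HOME/MEMO-es.md §37.13 [cite: DarmonDiamondTaylor1995, Lemma 4.28 (p. 135)].
-/

set_option autoImplicit false
set_option linter.dupNamespace false

open scoped MatrixGroups

open CongruenceSubgroup Matrix.SpecialLinearGroup
open Summit.BirchSwinnertonDyer.Rank1Residual.ManinAdditive.NineShiftEqualiser (slOf g0Of slOf_apply_00 slOf_apply_01
  slOf_apply_10 slOf_apply_11 slOf_mem_gamma0 g0Of_congr)
open Summit.BirchSwinnertonDyer.BirchSwinnertonDyer.Theorems.ManinLocalTwoThree.ThreeShiftDescent (g0Of_mul det_mul_entries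
  Tpow Tpow_mul_Tpow Tpow_zero Tpow_inv g0Of_mul_Tpow Tpow_one_mul_mul_Tpow_neg_one conj_invariant_of_generator glue)

namespace Summit.BirchSwinnertonDyer.BirchSwinnertonDyer.Theorems.ManinLocalTwoThree

namespace TwoShift

section Eigen

variable {K : Type*} [Field K] [CharP K 2]

/-! ### §1. The `K`-valued diamond `d`-functions `χ₄ ∘ d`, `χ₈ ∘ d` on `Γ₀(2m)`: additive on `A` and on `B`, not on `Γ₀(2m)` -/

/-- `χ₄(d_γ)` with values in `K`. [folklore] -/
noncomputable def chi4K (L : ℕ) (γ : Gamma0 L) : K := ZMod.castHom (dvd_refl 2) K (chi4d L γ)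

/-- `χ₈(d_γ)` with values in `K`. [folklore] -/
noncomputable def chi8K (L : ℕ) (γ : Gamma0 L) : K := ZMod.castHom (dvd_refl 2) K (chi8d L γ)

variable {m : ℕ}

/-- `2 ∣ c_x` for `x ∈ Γ₀(2m)`. [folklore] -/
theorem two_dvd_c (x : Gamma0 (2 * m)) : (2 : ℤ) ∣ ((x : SL(2, ℤ)) 1 0 : ℤ) :=
  (show (2 : ℤ) ∣ ((2 * m : ℕ) : ℤ) from ⟨m, by push_cast; ring⟩).trans (level_dvd_c x)

/-- `χ₄ ∘ d` is additive on `A = {2 ∣ b} ≤ Γ₀(2m)` (`4 ∣ c_x b_y`). [folklore] -/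
theorem chi4K_add_subA : ∀ x ∈ subA m, ∀ y ∈ subA m, (chi4K _ (x * y) : K) = chi4K _ x + chi4K _ y := by
  intro x hx y hy
  unfold chi4K
  rw [chi4d_mul x y ?_ (two_dvd_c x) (two_dvd_c y), map_add]
  obtain ⟨u, hu⟩ := two_dvd_c x
  obtain ⟨v, hv⟩ := (mem_subA m).mp hy
  exact ⟨u * v, by rw [hu, hv]; ring⟩

/-- `χ₄ ∘ d` is additive on `B = Γ₀(4m)` (`4 ∣ c_x`). [folklore] -/
theorem chi4K_add_subB : ∀ x ∈ subB m, ∀ y ∈ subB m, (chi4K _ (x * y) : K) = chi4K _ x + chi4K _ y := by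
  intro x hx y hy
  unfold chi4K
  rw [chi4d_mul x y ?_ (two_dvd_c x) (two_dvd_c y), map_add]
  obtain ⟨u, hu⟩ := (mem_subB m).mp hx
  exact ⟨m * u * (y : SL(2, ℤ)) 0 1, by rw [hu]; push_cast; ring⟩

/-- `χ₈ ∘ d` is additive on `A = {2 ∣ b} ≤ Γ₀(4k)` (`8 ∣ c_x b_y`). [folklore] -/
theorem chi8K_add_subA {k : ℕ} : ∀ x ∈ subA (2 * k), ∀ y ∈ subA (2 * k), (chi8K _ (x * y) : K) = chi8K _ x + chi8K _ y := by
  intro x hx y hy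
  unfold chi8K
  rw [chi8d_mul x y ?_ (two_dvd_c x) (two_dvd_c y), map_add]
  obtain ⟨u, hu⟩ := level_dvd_c x
  obtain ⟨v, hv⟩ := (mem_subA (2 * k)).mp hy
  exact ⟨k * u * v, by rw [hu, hv]; push_cast; ring⟩

/-- `χ₈ ∘ d` is additive on `B = Γ₀(8k)` (`8 ∣ c_x`). [folklore] -/
theorem chi8K_add_subB {k : ℕ} : ∀ x ∈ subB (2 * k), ∀ y ∈ subB (2 * k), (chi8K _ (x * y) : K) = chi8K _ x + chi8K _ y := by
  intro x hx y hy
  unfold chi8K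
  rw [chi8d_mul x y ?_ (two_dvd_c x) (two_dvd_c y), map_add]
  obtain ⟨u, hu⟩ := (mem_subB (2 * k)).mp hx
  exact ⟨k * u * (y : SL(2, ℤ)) 0 1, by rw [hu]; push_cast; ring⟩

/-- `χ₄K` of an explicit matrix. [folklore] -/
theorem chi4K_g0Of {L : ℕ} (a b c d : ℤ) (h : a * d - b * c = 1) (hc : (L : ℤ) ∣ c) :
    (chi4K L (g0Of a b c d h hc) : K) = ZMod.castHom (dvd_refl 2) K (chi4 ((d : ℤ) : ZMod 4)) := rfl

/-- `χ₈K` of an explicit matrix. [folklore] -/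
theorem chi8K_g0Of {L : ℕ} (a b c d : ℤ) (h : a * d - b * c = 1) (hc : (L : ℤ) ∣ c) :
    (chi8K L (g0Of a b c d h hc) : K) = ZMod.castHom (dvd_refl 2) K (chi8 ((d : ℤ) : ZMod 8)) := rfl

/-- `T Q₁ T⁻¹ = (1 − 4m, 8m; −2m, 1 + 4m)` in `Γ₀(2m)`. [folklore] -/
theorem conj_Q1_eq : Tpow (2 * m) 1 * Q1 m * (Tpow (2 * m) 1)⁻¹ =
    g0Of (1 - 4 * m) (8 * m) (-(2 * m)) (1 + 4 * m) (by ring) ⟨-1, by push_cast; ring⟩ := by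
  rw [Tpow_inv, Q1, Tpow_one_mul_mul_Tpow_neg_one _ _ _ _ _ _ (by ring)]
  exact g0Of_congr (by ring) (by ring) rfl (by ring) _ _ _ _

/-! ### §2. The shared two-functional argument -/

/-- **Explicit-pair contradiction (abstract form).**  On `G = Γ₀(2m) ⊇ A, B` let `χ : G → K` be additive on `A` and on `B`, and `η` an
additive `ε`-eigenfunction on `Γ₀(4m)` (`ε ≠ 0`).  If `η(P_{1/2}) ≠ 0`, the pair `(χ − cst·ε·coshift η, χ − cst·η)` with
`cst = (χ(TQ₁T⁻¹) − χ(Q₁))·(ε η(P₁) − ε η(P_{1/2}))⁻¹` glues to an additive `W` on `G` with `W|_B = χ − cst·restrVal η` and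
`cst·(ε η(P₁) − ε η(P_{1/2})) = χ(TQ₁T⁻¹) − χ(Q₁)`. [folklore] -/
theorem exists_glued_of_ne (χ : Gamma0 (2 * m) → K) (hχA : ∀ x ∈ subA m, ∀ y ∈ subA m, χ (x * y) = χ x + χ y)
    (hχB : ∀ x ∈ subB m, ∀ y ∈ subB m, χ (x * y) = χ x + χ y)
    (η : Gamma0 (2 * (2 * m)) → K) (ε : K) (hε0 : ε ≠ 0) (hadd : IsAdd η) (hinv : IsShiftEigen ε η)
    (hne : η (Phalf m) ≠ 0) :
    ∃ (cst : K) (W : Gamma0 (2 * m) → K), (∀ g h, W (g * h) = W g + W h) ∧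
      (∀ b ∈ subB m, W b = χ b - cst * restrVal η b) ∧
      cst * (ε * η (Pone m) - ε * η (Phalf m)) = χ (Tpow (2 * m) 1 * Q1 m * (Tpow (2 * m) 1)⁻¹) - χ (Q1 m) := by
  have hAn := subA_normal m
  have hα := alpha_add (m := m) η ε hadd
  have hφ' := restr_add (m := m) η hadd
  have hC := alpha_eq_restr (m := m) η ε hinv
  have ht : Tpow (2 * m) 1 ∈ subB m := Tpow_mem_subB 1
  have hD : ε * η (Pone m) - ε * η (Phalf m) ≠ 0 := by
    rw [apply_Pone_eq_zero η ε CharTwo.two_eq_zero hadd hinv, mul_zero, zero_sub, neg_ne_zero]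
    exact mul_ne_zero hε0 hne
  set cst : K := (χ (Tpow (2 * m) 1 * Q1 m * (Tpow (2 * m) 1)⁻¹) - χ (Q1 m)) * (ε * η (Pone m) - ε * η (Phalf m))⁻¹
    with hcst
  set α₂ : Gamma0 (2 * m) → K := fun g => χ g - cst * (ε * coshiftVal η g) with hα₂
  set φ₂ : Gamma0 (2 * m) → K := fun g => χ g - cst * restrVal η g with hφ₂
  have hα₂A : ∀ x ∈ subA m, ∀ y ∈ subA m, α₂ (x * y) = α₂ x + α₂ y := by
    intro x hx y hy
    simp only [hα₂, hχA x hx y hy, hα x hx y hy]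
    ring
  have hφ₂B : ∀ x ∈ subB m, ∀ y ∈ subB m, φ₂ (x * y) = φ₂ x + φ₂ y := by
    intro x hx y hy
    simp only [hφ₂, hχB x hx y hy, hφ' x hx y hy]
    ring
  have hC₂ : ∀ x ∈ subA m, x ∈ subB m → α₂ x = φ₂ x := by
    intro x hx hxB
    simp only [hα₂, hφ₂, hC x hx hxB]
  have hκ : α₂ (Tpow (2 * m) 1 * Q1 m * (Tpow (2 * m) 1)⁻¹) = α₂ (Q1 m) := by
    simp only [hα₂]
    rw [coshiftVal_conj_Q1, coshiftVal_Q1, sub_eq_sub_iff_sub_eq_sub, ← mul_sub, hcst, inv_mul_cancel_right₀ hD]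
  have hinvT := conj_invariant_of_generator hAn hα₂A hφ₂B hC₂ ht Q1_mem_subA exists_mul_Q1_zpow_mem_subB hκ
  obtain ⟨hW, -, hWB⟩ := glue hAn hα₂A hφ₂B hC₂ ht hinvT
    (fun g => ((g : SL(2, ℤ)) 0 0 : ℤ) * (g : SL(2, ℤ)) 0 1) mul_Tpow_neg_mem_subA Tpow_n_mem_subA
  refine ⟨cst, fun g => α₂ (g * Tpow (2 * m) 1 ^ (-(((g : SL(2, ℤ)) 0 0 : ℤ) * (g : SL(2, ℤ)) 0 1))) +
      (((g : SL(2, ℤ)) 0 0 : ℤ) * (g : SL(2, ℤ)) 0 1) • φ₂ (Tpow (2 * m) 1), hW, ?_, ?_⟩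
  · intro b hb
    exact hWB b hb
  · rw [hcst, inv_mul_cancel_right₀ hD]

omit [CharP K 2] in
/-- from `cst·(−ε·v) = −1`-type bookkeeping: if `cst·v = 1` and `cst·(ε·0 − ε·v) = 0 − 1` then `ε = 1`. [folklore] -/
theorem eps_eq_one_of_bookkeeping {ε cst v : K} (h1 : cst * v = 1) (h2 : cst * (ε * 0 - ε * v) = 0 - 1) : ε = 1 := by
  have h3 : ε * (cst * v) = 1 := by linear_combination -h2
  rw [h1, mul_one] at h3
  exact h3

/-! ### §3. `m` odd: the pair `χ₄ ∘ d` and the conjugator `g` with `g(1,2)ᵀ = (1,8)ᵀ` -/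

/-- `P_{1/2}` as an element of `Γ₀(2m)` (it lies in `B`). [folklore] -/
def PhalfG (m : ℕ) : Gamma0 (2 * m) :=
  g0Of (1 - 2 * m) m (-(4 * m)) (1 + 2 * m) (by ring) ⟨-2, by push_cast; ring⟩

/-- `P_{1/2} ∈ B`. [folklore] -/
theorem PhalfG_mem_subB : PhalfG m ∈ subB m := g0Of_mem_subB _ _ _ _ _ _ ⟨-1, by push_cast; ring⟩

omit [CharP K 2] in
/-- `restrVal η P_{1/2} = η(P_{1/2})`. [folklore] -/
theorem restrVal_PhalfG (η : Gamma0 (2 * (2 * m)) → K) : restrVal η (PhalfG m) = η (Phalf m) := by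
  rw [PhalfG, restrVal_g0Of η _ _ _ _ _ _ ⟨-1, by push_cast; ring⟩]
  rfl

/-- `y = (1 − 8m, m; −64m, 1 + 8m)` as an element of `Γ₀(2m)` (the generator of the stabiliser of `1/8` in `Γ₀(4m)`). [folklore] -/
def yEl (m : ℕ) : Gamma0 (2 * m) :=
  g0Of (1 - 8 * m) m (-(64 * m)) (1 + 8 * m) (by ring) ⟨-32, by push_cast; ring⟩

/-- `y ∈ B`. [folklore] -/
theorem yEl_mem_subB : yEl m ∈ subB m := g0Of_mem_subB _ _ _ _ _ _ ⟨-16, by push_cast; ring⟩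

/-- `y` at level `4m`. [folklore] -/
def yB (m : ℕ) : Gamma0 (2 * (2 * m)) :=
  g0Of (1 - 8 * m) m (-(64 * m)) (1 + 8 * m) (by ring) ⟨-16, by push_cast; ring⟩

omit [CharP K 2] in
/-- `restrVal η y = η(y)`. [folklore] -/
theorem restrVal_yEl (η : Gamma0 (2 * (2 * m)) → K) : restrVal η (yEl m) = η (yB m) := by
  rw [yEl, restrVal_g0Of η _ _ _ _ _ _ ⟨-16, by push_cast; ring⟩]
  rfl

/-- **`η(y) = 0`** for an additive `ε`-eigenfunction (`ε ≠ 0`): `diag(2,1) y diag(2,1)⁻¹ = (1−8m, 2m; −32m, 1+8m) = u_{1/4}²`,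
`u_{1/4} = (1−4m, m; −16m, 1+4m) ∈ Γ₀(4m)`. [folklore] -/
theorem apply_yB_eq_zero (η : Gamma0 (2 * (2 * m)) → K) (ε : K) (hε0 : ε ≠ 0) (hadd : IsAdd η) (hinv : IsShiftEigen ε η) :
    η (yB m) = 0 := by
  have hsq : (g0Of (1 - 4 * m) m (-(16 * m)) (1 + 4 * m) (by ring) ⟨-4, by push_cast; ring⟩ : Gamma0 (2 * (2 * m))) *
      g0Of (1 - 4 * m) m (-(16 * m)) (1 + 4 * m) (by ring) ⟨-4, by push_cast; ring⟩ =
      g0Of (1 - 8 * m) (2 * m) (-(32 * m)) (1 + 8 * m) (by ring) ⟨-8, by push_cast; ring⟩ := by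
    have e : (g0Of (1 - 4 * m) m (-(16 * m)) (1 + 4 * m) (by ring) ⟨-4, by push_cast; ring⟩ : Gamma0 (2 * (2 * m))) =
        g0Of (1 + -(4 * (m : ℤ))) m (-(16 * m)) (1 - -(4 * (m : ℤ))) (by ring) ⟨-4, by push_cast; ring⟩ :=
      g0Of_congr (by ring) rfl rfl (by ring) _ _ _ _
    rw [e, g0Of_sq_of_sq_zero (L := 2 * (2 * m)) (-(4 * (m : ℤ))) m (-(16 * m)) (by ring) (by ring) (by ring)
      ⟨-4, by push_cast; ring⟩ ⟨-8, by push_cast; ring⟩]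
    exact g0Of_congr (by ring) (by ring) (by ring) (by ring) _ _ _ _
  have key := hinv (1 - 8 * m) m (-(32 * m)) (1 + 8 * m) (by ring) ⟨-8, by push_cast; ring⟩
  have e2 : (g0Of (1 - 8 * m) m (2 * -(32 * m)) (1 + 8 * m) (by ring) (Dvd.dvd.mul_left ⟨-8, by push_cast; ring⟩ 2)
      : Gamma0 (2 * (2 * m))) = yB m := g0Of_congr rfl rfl (by ring) rfl _ _ _ _
  rw [e2, ← hsq, hadd.map_sq_eq_zero CharTwo.two_eq_zero] at key
  rcases mul_eq_zero.mp key.symm with h | h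
  · exact absurd h hε0
  · exact h

/-- `m` odd gives `t` with `m² = 1 + 8t`. [folklore] -/
theorem exists_sq_eq_one_add_eight_mul (hm : Odd m) : ∃ t : ℤ, (m : ℤ) * m = 1 + 8 * t := by
  obtain ⟨k, rfl⟩ := hm
  obtain ⟨s, hs⟩ := Nat.even_mul_succ_self k
  refine ⟨s, ?_⟩
  have hs' : ((k : ℤ)) * (k + 1) = s + s := by exact_mod_cast hs
  push_cast
  linear_combination 4 * hs'

/-- **The explicit conjugator** `g = (1 + 6t, −3t; 6m², 4 − 3m²) ∈ Γ₀(2m)` (`m² = 1 + 8t`), with `g (1,2)ᵀ = (1,8)ᵀ`. [folklore] -/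
def gEl (m : ℕ) (t : ℤ) (ht : (m : ℤ) * m = 1 + 8 * t) : Gamma0 (2 * m) :=
  g0Of (1 + 6 * t) (-3 * t) (6 * m * m) (4 - 3 * m * m) (by linear_combination (-3) * ht)
    ⟨3 * (m : ℤ), by push_cast; ring⟩

/-- **`g P_{1/2} = y g`** in `Γ₀(2m)` (`g N_{(1,2)} g⁻¹ = N_{(1,8)}`; a polynomial identity modulo `m² = 1 + 8t`). [folklore] -/
theorem gEl_mul_PhalfG (t : ℤ) (ht : (m : ℤ) * m = 1 + 8 * t) :
    gEl m t ht * PhalfG m = yEl m * gEl m t ht := by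
  unfold gEl PhalfG yEl
  rw [g0Of_mul _ _ _ _ _ _ _ _ _ _ _ _ (det_mul_entries (by linear_combination (-3) * ht) (by ring))
      (dvd_add (Dvd.dvd.mul_right ⟨3 * (m : ℤ), by push_cast; ring⟩ _) (Dvd.dvd.mul_left ⟨-2, by push_cast; ring⟩ _)),
    g0Of_mul _ _ _ _ _ _ _ _ _ _ _ _ (det_mul_entries (by ring) (by linear_combination (-3) * ht))
      (dvd_add (Dvd.dvd.mul_right ⟨-32, by push_cast; ring⟩ _) (Dvd.dvd.mul_left ⟨3 * (m : ℤ), by push_cast; ring⟩ _))]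
  exact g0Of_congr (by linear_combination (-(6 : ℤ) * m) * ht) (by linear_combination (3 * (m : ℤ)) * ht)
    (by linear_combination (-(48 : ℤ) * m) * ht) (by linear_combination (24 * (m : ℤ)) * ht) _ _ _ _

/-- **`m` odd, `ε ≠ 0, 1`: `η(P_{1/2}) = 0`** for every additive `ε`-eigenfunction `η : Γ₀(4m) → K` (the `χ₄`-pair contradiction). [folklore] -/
theorem apply_Phalf_eq_zero_of_odd (hm : Odd m) (η : Gamma0 (2 * (2 * m)) → K) (ε : K) (hε0 : ε ≠ 0) (hε1 : ε ≠ 1)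
    (hadd : IsAdd η) (hinv : IsShiftEigen ε η) : η (Phalf m) = 0 := by
  by_contra hne
  obtain ⟨t, ht⟩ := exists_sq_eq_one_add_eight_mul hm
  obtain ⟨cst, W, hW, hWB, hcD⟩ :=
    exists_glued_of_ne (chi4K (2 * m)) chi4K_add_subA chi4K_add_subB η ε hε0 hadd hinv hne
  -- evaluate `W` on `g P_{1/2} = y g`
  have h1 := hW (gEl m t ht) (PhalfG m)
  have h2 := hW (yEl m) (gEl m t ht)
  rw [gEl_mul_PhalfG t ht] at h1
  have h12 : W (PhalfG m) = W (yEl m) := by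
    have := h1.symm.trans h2
    linear_combination this
  rw [hWB _ PhalfG_mem_subB, hWB _ yEl_mem_subB, restrVal_PhalfG, restrVal_yEl, apply_yB_eq_zero η ε hε0 hadd hinv,
    PhalfG, yEl, chi4K_g0Of, chi4K_g0Of] at h12
  -- the character values
  have hm' : Odd (m : ℤ) := by exact_mod_cast hm
  have v1 : chi4 (((1 + 2 * m : ℤ)) : ZMod 4) = 1 := (chi4_one_add (m : ℤ)).2 hm'
  have v2 : chi4 (((1 + 8 * m : ℤ)) : ZMod 4) = 0 := by
    have := (chi4_one_add (2 * (m : ℤ))).1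
    rw [show (1 + 4 * (2 * (m : ℤ))) = 1 + 8 * m by ring] at this
    exact this
  rw [v1, v2, map_one, map_zero, mul_zero, sub_zero, sub_eq_zero] at h12
  -- `h12 : 1 = cst * η P_{1/2}`; the defect of the `χ₄`-pair
  rw [conj_Q1_eq, Q1, chi4K_g0Of, chi4K_g0Of] at hcD
  have v3 : chi4 (((1 + 4 * m : ℤ)) : ZMod 4) = 0 := (chi4_one_add (m : ℤ)).1
  rw [v1, v3, map_one, map_zero, apply_Pone_eq_zero η ε CharTwo.two_eq_zero hadd hinv] at hcD
  exact hε1 (eps_eq_one_of_bookkeeping h12.symm hcD)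

/-! ### §4. `m = 2k`, `k` odd: the pair `χ₈ ∘ d` and `P_{1/2} = x²` -/

/-- `x = (1 − 2k, k; −4k, 1 + 2k) ∈ Γ₀(4k)` with `x² = P_{1/2}` (level `8k`). [folklore] -/
def xEl (k : ℕ) : Gamma0 (2 * (2 * k)) :=
  g0Of (1 - 2 * k) k (-(4 * k)) (1 + 2 * k) (by ring) ⟨-1, by push_cast; ring⟩

/-- `x · x = P_{1/2}` in `Γ₀(4k)`. [folklore] -/
theorem xEl_sq {k : ℕ} : xEl k * xEl k = PhalfG (2 * k) := by
  unfold xEl PhalfG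
  have e : (g0Of (1 - 2 * k) k (-(4 * k)) (1 + 2 * k) (by ring) ⟨-1, by push_cast; ring⟩ : Gamma0 (2 * (2 * k))) =
      g0Of (1 + -(2 * (k : ℤ))) k (-(4 * k)) (1 - -(2 * (k : ℤ))) (by ring) ⟨-1, by push_cast; ring⟩ :=
    g0Of_congr (by ring) rfl rfl (by ring) _ _ _ _
  rw [e, g0Of_sq_of_sq_zero (L := 2 * (2 * k)) (-(2 * (k : ℤ))) k (-(4 * k)) (by ring) (by ring) (by ring)
    ⟨-1, by push_cast; ring⟩ ⟨-2, by push_cast; ring⟩]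
  exact g0Of_congr (by push_cast; ring) (by push_cast; ring) (by push_cast; ring) (by push_cast; ring) _ _ _ _

/-- **`m = 2k`, `k` odd, `ε ≠ 0, 1`: `η(P_{1/2}) = 0`** for every additive `ε`-eigenfunction `η : Γ₀(8k) → K` (the `χ₈`-pair). [folklore] -/
theorem apply_Phalf_eq_zero_of_two_mul_odd {k : ℕ} (hk : Odd k) (η : Gamma0 (2 * (2 * (2 * k))) → K) (ε : K)
    (hε0 : ε ≠ 0) (hε1 : ε ≠ 1) (hadd : IsAdd η) (hinv : IsShiftEigen ε η) : η (Phalf (2 * k)) = 0 := by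
  by_contra hne
  obtain ⟨cst, W, hW, hWB, hcD⟩ :=
    exists_glued_of_ne (m := 2 * k) (chi8K (2 * (2 * k))) chi8K_add_subA chi8K_add_subB η ε hε0 hadd hinv hne
  -- `W(P_{1/2}) = W(x²) = 0`
  have h0 : W (PhalfG (2 * k)) = 0 := by
    rw [← xEl_sq, hW, ← two_mul, CharTwo.two_eq_zero, zero_mul]
  rw [hWB _ PhalfG_mem_subB, restrVal_PhalfG, PhalfG, chi8K_g0Of] at h0
  have hk' : Odd (k : ℤ) := by exact_mod_cast hk
  have v1 : chi8 (((1 + 2 * ((2 * k : ℕ) : ℤ) : ℤ)) : ZMod 8) = 1 := by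
    have := (chi8_one_add (k : ℤ)).2 hk'
    rw [show (((1 + 2 * ((2 * k : ℕ) : ℤ) : ℤ)) : ZMod 8) = (((1 + 4 * (k : ℤ) : ℤ)) : ZMod 8) by push_cast; ring]
    exact this
  have v3 : chi8 (((1 + 4 * ((2 * k : ℕ) : ℤ) : ℤ)) : ZMod 8) = 0 := by
    have := (chi8_one_add (k : ℤ)).1
    rw [show (((1 + 4 * ((2 * k : ℕ) : ℤ) : ℤ)) : ZMod 8) = (((1 + 8 * (k : ℤ) : ℤ)) : ZMod 8) by push_cast; ring]
    exact this
  rw [v1, map_one, sub_eq_zero] at h0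
  rw [conj_Q1_eq, Q1, chi8K_g0Of, chi8K_g0Of] at hcD
  rw [v1, v3, map_one, map_zero, apply_Pone_eq_zero η ε CharTwo.two_eq_zero hadd hinv] at hcD
  exact hε1 (eps_eq_one_of_bookkeeping h0.symm hcD)

/-! ### §5. The eigen step and the eigen tower -/

/-- **NO OBSTRUCTION for `ε ≠ 0, 1` at ANY depth:** `η(P_{1/2}) = 0` for every additive `ε`-eigenfunction `η : Γ₀(4m) → K`. [folklore] -/
theorem apply_Phalf_eq_zero_of_ne_one (m : ℕ) (η : Gamma0 (2 * (2 * m)) → K) (ε : K) (hε0 : ε ≠ 0) (hε1 : ε ≠ 1)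
    (hadd : IsAdd η) (hinv : IsShiftEigen ε η) : η (Phalf m) = 0 := by
  rcases Nat.even_or_odd m with ⟨k, rfl⟩ | hm
  · rcases Nat.even_or_odd k with ⟨j, rfl⟩ | hk
    · have e : j + j + (j + j) = 4 * j := by ring
      revert η
      rw [e]
      intro η hadd hinv
      exact apply_Phalf_eq_zero_of_four_dvd ε η CharTwo.two_eq_zero hadd hinv
    · revert η
      rw [← two_mul]
      intro η hadd hinv
      exact apply_Phalf_eq_zero_of_two_mul_odd hk η ε hε0 hε1 hadd hinv
  · exact apply_Phalf_eq_zero_of_odd hm η ε hε0 hε1 hadd hinv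

/-- **THE EIGEN STEP at every `m`: `K^ε(2m) = 0 ⟹ K^ε(4m) = 0`** (`ε ≠ 0, 1`). [folklore] -/
theorem eigen_step (m : ℕ) (ε : K) (hε0 : ε ≠ 0) (hε1 : ε ≠ 1) (hyp : ShiftEigenTrivialAt (2 * m) ε) :
    ShiftEigenTrivialAt (2 * (2 * m)) ε := by
  intro η hadd hinv γ
  have hP : η (Pone m) = η (Phalf m) := by
    rw [apply_Pone_eq_zero η ε CharTwo.two_eq_zero hadd hinv, apply_Phalf_eq_zero_of_ne_one m η ε hε0 hε1 hadd hinv]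
  obtain ⟨w, hwadd, hwinv, hres⟩ := descent η ε hadd hinv hP
  exact eq_zero_of_restrictsFrom (dvd_mul_left (2 * m) 2) hres (hyp w hwadd hwinv) γ

/-- **THE EIGEN TOWER: `K^ε(2^(k+1) N₁) = 0` from `K^ε(2N₁) = 0`**, every `N₁`, every `k` (`ε ≠ 0, 1`). [folklore] -/
theorem shiftEigenTrivialAt_of_two_mul (N₁ : ℕ) (ε : K) (hε0 : ε ≠ 0) (hε1 : ε ≠ 1) (h : ShiftEigenTrivialAt (2 * N₁) ε)
    (k : ℕ) : ShiftEigenTrivialAt (2 ^ (k + 1) * N₁) ε := by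
  induction k with
  | zero => simpa using h
  | succ k ih =>
    have e : 2 ^ (k + 1 + 1) * N₁ = 2 * (2 * (2 ^ k * N₁)) := by ring
    have e' : 2 ^ (k + 1) * N₁ = 2 * (2 ^ k * N₁) := by ring
    rw [e]
    rw [e'] at ih
    exact eigen_step _ ε hε0 hε1 ih

end Eigen

end TwoShift

end Summit.BirchSwinnertonDyer.BirchSwinnertonDyer.Theorems.ManinLocalTwoThree
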